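import Mathlib
import HarnessLib

/-!
# The Johnson rank lemma: alternating pair sums of an `S_N`-invariant family are linearly independent
(crux `OrbitRestorationQP`, stmt-ValiantsHypothesis-18293 — lane SML: the column-set-multilinear `ΣΠΣ` stratum of A_∞)

Abstract linear algebra behind the rank lower bound of the set-multilinear stratum (blueprint
`SML-STRATUM-BLUEPRINT.md` on the crux item).  Data: a `ℂ`-module `V` with a DEFINITE sesquilinear form `B`
(`B v v = 0 → v = 0`), a family `u : (Fin j → Fin N) → V` whose Gram values are invariant under the diagonal
action of `Equiv.Perm (Fin N)` (`B (u (g ∘ ρ)) (u (g ∘ ρ')) = B (u ρ) (u ρ')`), an injective `b : Fin j → Fin N`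
and injective `a x : Fin j → Fin N` (`x : ι`) avoiding the range of `b`, with pairwise distinct ranges.  The
ALTERNATING PAIR SUMS are

  `e x = Σ_{ε : Fin j → Bool} (-1)^{#ε} • u (mix (a x) b ε)`,   `mix a b ε i = if ε i then b i else a i`

(for `u ρ = ∂_ρ p` these are the iterated difference derivatives `Π_i (∂_{a x i} - ∂_{b i}) p`).

* `pair_flip_zero` — if some pair `{a i, b i}` misses the range of `ρ'`, then `B (u ρ') (e) = 0` (flip `ε i` with
  the transposition `(a i  b i)`, which fixes `ρ'`);
* `diag_sign` — `B (u (mix a b ε')) e = (-1)^{#ε'} · B (u a) e`; hence `B e e = 2^j · B (u a) e`;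
* `johnson_linearIndependent` — if every `e x ≠ 0` then `x ↦ e x` is linearly independent; and the numeric form
  `johnson_card_le`: if all `u ρ` lie in the span of a finite set `w`, then `Fintype.card ι ≤ w.card`.
With `ι` = the `j`-subsets of `(range b)ᶜ` this is the bound `C(N-j, j) ≤ rank`.  [folklore; the computation is
the eigenvalue of the Johnson scheme on the Specht module `S^{(N-j,j)}`, done here without representation theory]
-/

set_option linter.dupNamespace false

namespace Summit.ValiantsHypothesis.ValiantsHypothesis.Theorems.SmlJohnsonRank

open Finset

variable {V : Type*} [AddCommGroup V] [Module ℂ V] {N j : ℕ}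

/-- Flipping one coordinate of `ε` changes the sign `(-1)^{#ε}`. [folklore] -/
theorem sign_update_not (ε : Fin j → Bool) (i₀ : Fin j) :
    ((-1 : ℂ) ^ (univ.filter fun i => Function.update ε i₀ (!ε i₀) i = true).card) =
      -((-1 : ℂ) ^ (univ.filter fun i => ε i = true).card) := by
  have hsplit : ∀ η : Fin j → Bool, (univ.filter fun i => η i = true).card =
      (if η i₀ = true then 1 else 0) + ((univ.erase i₀).filter fun i => η i = true).card := by
    intro η
    rw [← Finset.insert_erase (Finset.mem_univ i₀), Finset.filter_insert]
    split_ifs with h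
    · rw [Finset.card_insert_of_notMem (by simp), Finset.insert_erase (Finset.mem_univ i₀)]; omega
    · rw [Finset.insert_erase (Finset.mem_univ i₀)]; simp
  have hrest : ((univ.erase i₀).filter fun i => Function.update ε i₀ (!ε i₀) i = true) =
      ((univ.erase i₀).filter fun i => ε i = true) := by
    refine Finset.filter_congr fun i hi => ?_
    rw [Function.update_of_ne (Finset.ne_of_mem_erase hi)]
  rw [hsplit (Function.update ε i₀ (!ε i₀)), hsplit ε, hrest, Function.update_self]
  cases ε i₀ <;> simp [pow_add]

/-- The transposition `(a i₀  b i₀)` flips coordinate `i₀` of the mixed tuple (all `2j` values distinct). [folklore] -/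
theorem swap_comp_mix (a b : Fin j → Fin N) (ha : Function.Injective a) (hb : Function.Injective b)
    (hab : ∀ i i', a i ≠ b i') (i₀ : Fin j) (ε : Fin j → Bool) :
    (Equiv.swap (a i₀) (b i₀)) ∘ (fun i => if ε i then b i else a i) =
      fun i => if Function.update ε i₀ (!ε i₀) i then b i else a i := by
  funext i
  simp only [Function.comp_apply]
  by_cases hi : i = i₀
  · subst hi
    rw [Function.update_self]
    cases ε i <;> simp [Equiv.swap_apply_left, Equiv.swap_apply_right]
  · rw [Function.update_of_ne hi]
    cases ε i
    · simp only [Bool.false_eq_true, if_false]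
      exact Equiv.swap_apply_of_ne_of_ne (fun h => hi (ha h)) (hab i i₀)
    · simp only [if_true]
      exact Equiv.swap_apply_of_ne_of_ne (fun h => hab i₀ i h.symm) (fun h => hi (hb h))

/-- **Flip lemma.**  If the pair `{a i₀, b i₀}` misses the range of `ρ'`, the alternating pair sum is
`B`-orthogonal to `u ρ'`. [folklore] -/
theorem pair_flip_zero (B : V →ₗ⋆[ℂ] V →ₗ[ℂ] ℂ) (u : (Fin j → Fin N) → V)
    (hinv : ∀ (g : Equiv.Perm (Fin N)) (ρ ρ' : Fin j → Fin N), B (u (g ∘ ρ)) (u (g ∘ ρ')) = B (u ρ) (u ρ'))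
    (a b : Fin j → Fin N) (ha : Function.Injective a) (hb : Function.Injective b) (hab : ∀ i i', a i ≠ b i')
    (ρ' : Fin j → Fin N) (i₀ : Fin j) (hρa : ∀ k, ρ' k ≠ a i₀) (hρb : ∀ k, ρ' k ≠ b i₀) :
    B (u ρ') (∑ ε : Fin j → Bool, ((-1 : ℂ) ^ (univ.filter fun i => ε i = true).card) •
      u (fun i => if ε i then b i else a i)) = 0 := by
  rw [map_sum]
  simp only [map_smul, smul_eq_mul]
  -- the involution `ε ↦ update ε i₀ (!ε i₀)` pairs terms with opposite signs
  refine Finset.sum_ninvolution (fun ε => Function.update ε i₀ (!ε i₀)) ?_ ?_ (fun _ => Finset.mem_univ _) ?_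
  · intro ε
    have hfix : (Equiv.swap (a i₀) (b i₀)) ∘ ρ' = ρ' := by
      funext k; exact Equiv.swap_apply_of_ne_of_ne (hρa k) (hρb k)
    have hkey : B (u ρ') (u (fun i => if Function.update ε i₀ (!ε i₀) i then b i else a i)) =
        B (u ρ') (u (fun i => if ε i then b i else a i)) := by
      calc B (u ρ') (u (fun i => if Function.update ε i₀ (!ε i₀) i then b i else a i))
          = B (u ((Equiv.swap (a i₀) (b i₀)) ∘ ρ'))
              (u ((Equiv.swap (a i₀) (b i₀)) ∘ (fun i => if ε i then b i else a i))) := by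
            rw [hfix, swap_comp_mix a b ha hb hab i₀ ε]
        _ = B (u ρ') (u (fun i => if ε i then b i else a i)) := hinv _ _ _
    rw [hkey, sign_update_not]
    ring
  · intro ε _ h
    have := congrFun h i₀
    rw [Function.update_self] at this
    cases hε : ε i₀ <;> simp [hε] at this
  · intro ε
    funext i
    by_cases hi : i = i₀
    · subst hi; simp
    · simp [Function.update_of_ne hi]

/-- **Diagonal sign lemma.**  `B (u (mix a b ε')) e = (-1)^{#ε'} · B (u a) e` for the alternating pair sum `e`.
[folklore] -/
theorem diag_sign (B : V →ₗ⋆[ℂ] V →ₗ[ℂ] ℂ) (u : (Fin j → Fin N) → V)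
    (hinv : ∀ (g : Equiv.Perm (Fin N)) (ρ ρ' : Fin j → Fin N), B (u (g ∘ ρ)) (u (g ∘ ρ')) = B (u ρ) (u ρ'))
    (a b : Fin j → Fin N) (ha : Function.Injective a) (hb : Function.Injective b) (hab : ∀ i i', a i ≠ b i') :
    ∀ (n : ℕ) (ε' : Fin j → Bool), (univ.filter fun i => ε' i = true).card = n →
      B (u (fun i => if ε' i then b i else a i))
        (∑ ε : Fin j → Bool, ((-1 : ℂ) ^ (univ.filter fun i => ε i = true).card) •
          u (fun i => if ε i then b i else a i)) =
      ((-1 : ℂ) ^ n) * B (u a)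
        (∑ ε : Fin j → Bool, ((-1 : ℂ) ^ (univ.filter fun i => ε i = true).card) •
          u (fun i => if ε i then b i else a i)) := by
  intro n
  induction n with
  | zero =>
    intro ε' hε'
    have h0 := Finset.filter_eq_empty_iff.1 (Finset.card_eq_zero.1 hε')
    have hall : ∀ i, ε' i = false := fun i => by simpa using h0 (Finset.mem_univ i)
    have : (fun i => if ε' i then b i else a i) = a := by funext i; simp [hall i]
    rw [this, pow_zero, one_mul]
  | succ n ih =>
    intro ε' hε'
    -- pick a `true` coordinate and flip it
    obtain ⟨i₀, hi₀⟩ : ∃ i₀, ε' i₀ = true := by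
      by_contra h
      simp only [not_exists] at h
      have : (univ.filter fun i => ε' i = true) = ∅ := by
        ext i; simp [h i]
      rw [this, Finset.card_empty] at hε'
      omega
    set ε'' := Function.update ε' i₀ (!ε' i₀) with hε''
    have hcount : (univ.filter fun i => ε'' i = true).card = n := by
      have h1 := sign_update_not ε' i₀
      -- count directly: removing the true coordinate `i₀`
      have : (univ.filter fun i => ε' i = true) = insert i₀ (univ.filter fun i => ε'' i = true) := by
        ext i
        by_cases hi : i = i₀
        · subst hi; simp [hi₀]
        · simp [hε'', hi]
      rw [this, Finset.card_insert_of_notMem (by simp [hε'', hi₀])] at hε'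
      omega
    have hback : Function.update ε'' i₀ (!ε'' i₀) = ε' := by
      funext i
      by_cases hi : i = i₀
      · subst hi; simp [hε'']
      · simp [hε'', Function.update_of_ne hi]
    -- flip: `B (u (mix ε')) e = - B (u (mix ε'')) e`
    have hflip : B (u (fun i => if ε' i then b i else a i))
        (∑ ε : Fin j → Bool, ((-1 : ℂ) ^ (univ.filter fun i => ε i = true).card) •
          u (fun i => if ε i then b i else a i)) =
        -B (u (fun i => if ε'' i then b i else a i))
        (∑ ε : Fin j → Bool, ((-1 : ℂ) ^ (univ.filter fun i => ε i = true).card) •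
          u (fun i => if ε i then b i else a i)) := by
      rw [map_sum, map_sum]
      simp only [map_smul, smul_eq_mul]
      -- re-index the second sum by the involution `flip`
      rw [← Equiv.sum_comp (Equiv.mk (fun ε : Fin j → Bool => Function.update ε i₀ (!ε i₀))
        (fun ε => Function.update ε i₀ (!ε i₀)) (fun ε => by
          funext i; by_cases hi : i = i₀
          · subst hi; simp
          · simp [Function.update_of_ne hi]) (fun ε => by
          funext i; by_cases hi : i = i₀
          · subst hi; simp
          · simp [Function.update_of_ne hi]))
        (fun ε => ((-1 : ℂ) ^ (univ.filter fun i => ε i = true).card) *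
          B (u (fun i => if ε'' i then b i else a i)) (u (fun i => if ε i then b i else a i)))]
      simp only [Equiv.coe_fn_mk]
      rw [← Finset.sum_neg_distrib]
      refine Finset.sum_congr rfl fun ε _ => ?_
      rw [sign_update_not, ← swap_comp_mix a b ha hb hab i₀ ε]
      have hε''mix : (fun i => if ε'' i then b i else a i) =
          (Equiv.swap (a i₀) (b i₀)) ∘ (fun i => if ε' i then b i else a i) := by
        rw [swap_comp_mix a b ha hb hab i₀ ε']
      rw [hε''mix, hinv]
      ring
    rw [hflip, ih ε'' hcount, pow_succ]
    ring

/-- **Johnson linear independence.**  If every alternating pair sum `e x` is nonzero, then `x ↦ e x` is linearly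
independent (pairwise distinct ranges of the `a x`, all avoiding the range of `b`). [folklore] -/
theorem johnson_linearIndependent {ι : Type*} (B : V →ₗ⋆[ℂ] V →ₗ[ℂ] ℂ) (hB : ∀ v, B v v = 0 → v = 0)
    (u : (Fin j → Fin N) → V)
    (hinv : ∀ (g : Equiv.Perm (Fin N)) (ρ ρ' : Fin j → Fin N), B (u (g ∘ ρ)) (u (g ∘ ρ')) = B (u ρ) (u ρ'))
    (a : ι → Fin j → Fin N) (b : Fin j → Fin N) (ha : ∀ x, Function.Injective (a x))
    (hb : Function.Injective b) (hab : ∀ x i i', a x i ≠ b i')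
    (hsep : ∀ x y, x ≠ y → ∃ i, a y i ∉ Set.range (a x))
    (he : ∀ x, (∑ ε : Fin j → Bool, ((-1 : ℂ) ^ (univ.filter fun i => ε i = true).card) •
      u (fun i => if ε i then b i else a x i)) ≠ 0) :
    LinearIndependent ℂ (fun x => ∑ ε : Fin j → Bool,
      ((-1 : ℂ) ^ (univ.filter fun i => ε i = true).card) • u (fun i => if ε i then b i else a x i)) := by
  rw [linearIndependent_iff']
  intro s g hrel x₀ hx₀
  -- pair the relation with `u (a x₀)`
  have h := congrArg (fun v => B (u (a x₀)) v) hrel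
  rw [map_sum, map_zero] at h
  simp only [map_smul, smul_eq_mul] at h
  -- off-diagonal terms vanish
  have hoff : ∀ x ∈ s, x ≠ x₀ → B (u (a x₀)) (∑ ε : Fin j → Bool,
      ((-1 : ℂ) ^ (univ.filter fun i => ε i = true).card) • u (fun i => if ε i then b i else a x i)) = 0 := by
    intro x _ hx
    obtain ⟨i₀, hi₀⟩ := hsep x₀ x hx.symm
    refine pair_flip_zero B u hinv (a x) b (ha x) hb (hab x) (a x₀) i₀ (fun k hk => hi₀ ⟨k, hk⟩)
      (fun k hk => hab x₀ k i₀ hk)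
  rw [Finset.sum_eq_single x₀ (fun x hx hne => by rw [hoff x hx hne, mul_zero])
    (fun h' => absurd hx₀ h')] at h
  -- the diagonal term is `g x₀ * θ` with `2^j θ = B e e ≠ 0`
  have hθ : B (u (a x₀)) (∑ ε : Fin j → Bool,
      ((-1 : ℂ) ^ (univ.filter fun i => ε i = true).card) • u (fun i => if ε i then b i else a x₀ i)) ≠ 0 := by
    intro hzero
    apply he x₀
    apply hB
    -- expand the first argument
    have hexp : B (∑ ε : Fin j → Bool, ((-1 : ℂ) ^ (univ.filter fun i => ε i = true).card) •
        u (fun i => if ε i then b i else a x₀ i)) =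
        ∑ ε : Fin j → Bool, (starRingEnd ℂ) ((-1 : ℂ) ^ (univ.filter fun i => ε i = true).card) •
          B (u (fun i => if ε i then b i else a x₀ i)) := by
      rw [map_sum]
      exact Finset.sum_congr rfl fun ε _ => by rw [map_smulₛₗ]
    rw [hexp, LinearMap.sum_apply]
    refine Finset.sum_eq_zero fun ε' _ => ?_
    rw [LinearMap.smul_apply, diag_sign B u hinv (a x₀) b (ha x₀) hb (hab x₀) _ ε' rfl, hzero, mul_zero,
      smul_zero]
  exact (mul_eq_zero.1 h).resolve_right hθ

/-- **Numeric form.**  Under the hypotheses of `johnson_linearIndependent`, if all `u ρ` lie in the span of a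
finite set `w`, then `Fintype.card ι ≤ w.card`. [folklore] -/
theorem johnson_card_le {ι : Type*} [Fintype ι] (B : V →ₗ⋆[ℂ] V →ₗ[ℂ] ℂ) (hB : ∀ v, B v v = 0 → v = 0)
    (u : (Fin j → Fin N) → V)
    (hinv : ∀ (g : Equiv.Perm (Fin N)) (ρ ρ' : Fin j → Fin N), B (u (g ∘ ρ)) (u (g ∘ ρ')) = B (u ρ) (u ρ'))
    (a : ι → Fin j → Fin N) (b : Fin j → Fin N) (ha : ∀ x, Function.Injective (a x))
    (hb : Function.Injective b) (hab : ∀ x i i', a x i ≠ b i')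
    (hsep : ∀ x y, x ≠ y → ∃ i, a y i ∉ Set.range (a x))
    (he : ∀ x, (∑ ε : Fin j → Bool, ((-1 : ℂ) ^ (univ.filter fun i => ε i = true).card) •
      u (fun i => if ε i then b i else a x i)) ≠ 0)
    (w : Finset V) (hw : ∀ ρ, u ρ ∈ Submodule.span ℂ (w : Set V)) :
    Fintype.card ι ≤ w.card := by
  have hli := johnson_linearIndependent B hB u hinv a b ha hb hab hsep he
  have hrange : Set.range (fun x => ∑ ε : Fin j → Bool,
      ((-1 : ℂ) ^ (univ.filter fun i => ε i = true).card) • u (fun i => if ε i then b i else a x i)) ≤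
      Submodule.span ℂ ((w : Set V)) := by
    rintro _ ⟨x, rfl⟩
    exact Submodule.sum_mem _ fun ε _ => Submodule.smul_mem _ _ (hw _)
  have h := linearIndependent_le_span' _ hli (w : Set V) hrange
  rw [Cardinal.mk_fintype] at h
  simpa using h

end Summit.ValiantsHypothesis.ValiantsHypothesis.Theorems.SmlJohnsonRank
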